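import Literature.AnabelianGeometry.EtaleTheta.Discharge.Sec5DivisorTransportInducedByOfThm49

/-!
# [EtTh] §5, Thm. 5.7: a NORMALISED transport fixes both root divisors, and the anchored divisor transport is
# equivariant for the anchored automorphism transport — the Frobenioid half (T1) of the translation-freeness lemma (T-div)
# (pp. 325–326, 329–330 / PDF pp. 99–100, 103–104)

Mochizuki, *The étale theta function and its Frobenioid-theoretic manifestations*, Publ. RIMS **45** (2009): Prop. 5.3
p.325 (PDF p.99) («the automorphism `Ψ^Φ_{A_⊚}` of the monoid `Φ(A_⊚)` obtained by composing the isomorphism of divisor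
monoids induced by `Ψ` [cf. Corollary 3.8, (iii); [FrdI], Theorem 4.9] with the isomorphism `Φ(Ψ(A_⊚)) ⥲ Φ(A_⊚)` induced by
the chosen isomorphism `Ψ(A_⊚) ⥲ A_⊚`»), Thm. 5.7 p.330 (PDF p.104) («… up to possible multiplication by a `2l`-th root of
unity and possible translation by an element of … `l·ℤ`») [cite: MochizukiEtTh2009, Prop 5.3 p.325 (PDF p.99); Thm 5.7 p.330 (PDF p.104)];
[FrdI] Rem. 1.1.1 p.21 (`Div(φ ∘ ψ) = Base(ψ)^* Div(φ) + deg_Fr(φ)·Div(ψ)`), Thm. 4.9 p.88 [cite: MochizukiFrdI2008, Thm. 4.9 p.88].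

Cell abc-iut, layer L2, seat abc-iut-L2-d3 (gen 7), row R532 «(T-div)» of abc-iut-L2-lead (junction note J-C5 of
abc-iut-L2-d4, STATUS 2026-08-26T17:03:31Z).  PROOF-ONLY (0 definitions, no new named fact) over abc-iut-w6-d052's
`Discharge/Sec5DivisorTransportInducedByOfThm49.lean` (LINK (a): `DivisorTransportStub.ofThm49`, `pullIso`, `pullAut`).

WHY.  Print's Thm. 5.7 keeps the indeterminacy «possible translation by an element of `l·ℤ`»; the cell's final knit of Thm. 5.7
(`…_final_of_kummerRigid`, p446712) quantifies instead over NORMALISED transports `(a, b, w)` of the root pair —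
`hT : a⁻¹ ≫ Ψ(s^⊓_N) ≫ b = s^⊓_N`, `hT′ : a⁻¹ ≫ Ψ(s^⊔_N) ≫ b = s^⊔_N ≫ w` with `w` an automorphism (a unit) of `B_N` — and
its (C)-binder `hrigid` is consistent only because such transports are TRANSLATION-FREE (J-C5 (3): the `l·ℤ`-translates of
the theta trivialisation have a different DIVISOR).  (T-div) = «`hT ∧ hT′ ⇒ τ(γ̃_b) = 0`» splits into (T1) the Frobenioid
half (this file), (T2) the divisor geometry of `div(Θ̈)` on the chain of components (the stabiliser of the pole divisor in
`ℤ ⋊ {±1}` is the reflection), (T3) the dictionary «label action of the anchored divisor transport = action of the Galois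
shadow on the chain».  THIS FILE, for ANY `𝔉 : ThetaFrobenioid C D` with «isomorphisms are isometries» (`hiso`, a THEOREM at
the model presentation — `div_iso_eq_one_of_model`) and `induced` at `A_⊚` read as [FrdI] Thm. 4.9 (`IsInducedBy` at `ofThm49`):

* `div_comp_autHom_eq` — `Div(s ≫ w) = Div(s)` for an automorphism `w` ([FrdI] Rem. 1.1.1: `deg_Fr(w) = 1`, `Div(w) = 0`);
* **`exists_psiPhiN_fixes_rootPair_of_transport`** — under `hT`, `hT′` the `a`-ANCHORED divisor transport
  `ψ_a := (pullIso a)⁻¹ ∘ Ψ^Φ_{A_N} : Φ(A_N) ⥲ Φ(A_N)` FIXES `Div(s^⊓_N)` AND `Div(s^⊔_N)` (the unit `w` is invisible to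
  divisors) — «`θ_b^bs` stabilises `Div(s^⊔_N)`», J-C5's first step;
* **`psiPhiN_pullAut`** — `ψ_a` is EQUIVARIANT for the anchored transport of automorphisms: `ψ_a ∘ (u·) = (a⁻¹ Ψ(u) a·) ∘ ψ_a`
  on `Φ(A_N)` for every `u ∈ Aut_C(A_N)` (`g·` := `pullAut g`) — the naturality of `Ψ^Φ` ([FrdI] Thm. 4.9) read at the
  anchor; through `Aut_C(A_N) ↠ Aut_D(A_N^bs)` (Aut-ampleness) the map `u ↦ a⁻¹Ψ(u)a` covers the BASE SHADOW `θ_A` of `Ψ` at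
  `A_N^bs`, whose Galois shadow is the `γ̃` of the (C)-chain (abc-iut-w5-d013's `Sec5GaloisShadowOfBaseShadow`) — the typed
  half of (T3);
* `exists_psiPhiN_fixes_rootPair_equivariant_of_transport` — both together for the SAME `Ψ`-induced `e_N`; `…_of_model` — the
  same at the model presentation `𝔉.pre = PreFrobenioidData.ofModel …` (`ofBiKummerData` / `ofConnectedTemperoidData`: `rfl`)
  with `hiso` DISCHARGED ([FrdI] Thm. 5.2: `C → F_Φ` a pre-Frobenioid).
HONEST FRAMING: kernel-checked bookkeeping implications between typed statements about the §5 data; `induced` ([FrdI] Thm. 4.9)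
stays a NAMED input in its supplier's shape; nothing of [EtTh] is asserted for an actual curve; (T2)/(T3) are NOT here;
typed ≠ discharged; no side taken on anything downstream ([IUTchIII] Cor. 3.12 in particular).
-/

namespace Literature.AnabelianGeometry.EtaleTheta

open CategoryTheory Literature.AlgebraicGeometry.Frobenioids FrobenioidThetaDivisors

universe w v v' u u'

namespace ThetaFrobenioid

variable {C : Type u} [Category.{v} C] {D : Type u'} [Category.{v'} D] (𝔉 : ThetaFrobenioid.{w} C D)

/-- **`Div(s ≫ w) = Div(s)` for an automorphism `w`** ([FrdI] Rem. 1.1.1: `Div(w ∘ s) = Base(s)^* Div(w) + deg_Fr(w)·Div(s)`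
with `Div(w) = 0` — isomorphisms are isometries, `hiso` — and `deg_Fr(w) = 1`).  The unit `w` of a normalised transport
`a⁻¹ ≫ Ψ(s^⊔_N) ≫ b = s^⊔_N ≫ w` is invisible to divisors. [cite: MochizukiFrdI2008, Rem. 1.1.1 p.21] -/
theorem div_comp_autHom_eq (hiso : ∀ ⦃X Y : C⦄ (c : X ≅ Y), 𝔉.pre.div c.hom = 1) {A B : C} (s : A ⟶ B)
    (w : Aut B) : 𝔉.pre.div (s ≫ w.hom) = 𝔉.pre.div s := by
  rw [𝔉.pre.div_comp, hiso w, map_one, one_mul, degFr_hom_eq_one 𝔉 w, PNat.one_coe, pow_one]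

/-- **(T1), fixed points: a NORMALISED transport fixes both root divisors.**  For §5 data `𝔉` with isomorphisms isometries
(`hiso`) and `e = Ψ^Φ_{A_⊚}` induced by `Ψ` ([FrdI] Thm. 4.9, `IsInducedBy` at `ofThm49`), anchors `a : Ψ(A_N) ⥲ A_N`,
`b : Ψ(B_N) ⥲ B_N` and an automorphism `w` of `B_N` with `hT : a⁻¹ ≫ Ψ(s^⊓_N) ≫ b = s^⊓_N` and `hT′ : a⁻¹ ≫ Ψ(s^⊔_N) ≫ b = s^⊔_N ≫ w`,
the `A_N`-component `e_N = Ψ^Φ_{A_N}` of the same `Ψ^Φ` satisfies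
`(pullIso a)⁻¹ (e_N (Div s^⊓_N)) = Div s^⊓_N` and `(pullIso a)⁻¹ (e_N (Div s^⊔_N)) = Div s^⊔_N`: the anchored divisor transport
`ψ_a` FIXES the two root divisors (abc-iut-w6-d052's `exists_div_anchored_rootPair_eq_of_isInducedBy` + `hT`/`hT′` +
`div_comp_autHom_eq`). [cite: MochizukiEtTh2009, Thm 5.7 p.330 (PDF p.104); Prop 5.3 p.325 (PDF p.99)] -/
theorem exists_psiPhiN_fixes_rootPair_of_transport (hiso : ∀ ⦃X Y : C⦄ (c : X ≅ Y), 𝔉.pre.div c.hom = 1)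
    {Ψ : C ≌ C} {e : 𝔉.PhiAcirc ≃* 𝔉.pre.Mon (𝔉.base.obj (Ψ.functor.obj 𝔉.Acirc))}
    (h : (DivisorTransportStub.ofThm49 𝔉).IsInducedBy Ψ 𝔉.Acirc e)
    (a : Ψ.functor.obj 𝔉.AN ≅ 𝔉.AN) (b : Ψ.functor.obj 𝔉.BN ≅ 𝔉.BN) (w : Aut 𝔉.BN)
    (hT : a.inv ≫ Ψ.functor.map 𝔉.sCap ≫ b.hom = 𝔉.sCap)
    (hT' : a.inv ≫ Ψ.functor.map 𝔉.sCup ≫ b.hom = 𝔉.sCup ≫ w.hom) :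
    ∃ eN : 𝔉.pre.Mon (𝔉.base.obj 𝔉.AN) ≃* 𝔉.pre.Mon (𝔉.base.obj (Ψ.functor.obj 𝔉.AN)),
      (DivisorTransportStub.ofThm49 𝔉).IsInducedBy Ψ 𝔉.AN eN ∧
      (eN.trans (𝔉.pullIso a).symm) (𝔉.pre.div 𝔉.sCap) = 𝔉.pre.div 𝔉.sCap ∧
      (eN.trans (𝔉.pullIso a).symm) (𝔉.pre.div 𝔉.sCup) = 𝔉.pre.div 𝔉.sCup := by
  obtain ⟨eN, hN, hcap, hcup⟩ := exists_div_anchored_rootPair_eq_of_isInducedBy 𝔉 hiso h a b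
  refine ⟨eN, hN, ?_, ?_⟩
  · rw [MulEquiv.trans_apply, ← hcap, hT]
  · rw [MulEquiv.trans_apply, ← hcup, hT', div_comp_autHom_eq 𝔉 hiso]

/-- **(T1), equivariance: the anchored divisor transport intertwines the anchored automorphism transport.**  For the
`A_N`-component `e_N` of a `Ψ`-induced `Ψ^Φ` (`IsInducedBy` at `ofThm49`) and an anchor `a : Ψ(A_N) ⥲ A_N`, the automorphism
`ψ_a := (pullIso a)⁻¹ ∘ e_N` of `Φ(A_N)` satisfies, for every `u ∈ Aut_C(A_N)` and `x ∈ Φ(A_N)`,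
`ψ_a (u·x) = (a⁻¹ ≫ Ψ(u) ≫ a)·(ψ_a x)` (`g·` = `pullAut g`, pull-back along `(g⁻¹)^bs`) — the naturality of `Ψ^Φ` w.r.t.
pull-backs ([FrdI] Thm. 4.9) at the arrow `u⁻¹`, conjugated by the anchor.  Through Aut-ampleness `u ↦ a⁻¹Ψ(u)a` covers the
base shadow `θ_A` of `Ψ` at `A_N^bs`. [cite: MochizukiFrdI2008, Thm. 4.9 p.88] -/
theorem psiPhiN_pullAut {Ψ : C ≌ C} {eN : 𝔉.pre.Mon (𝔉.base.obj 𝔉.AN) ≃* 𝔉.pre.Mon (𝔉.base.obj (Ψ.functor.obj 𝔉.AN))}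
    (hN : (DivisorTransportStub.ofThm49 𝔉).IsInducedBy Ψ 𝔉.AN eN) (a : Ψ.functor.obj 𝔉.AN ≅ 𝔉.AN) (u : Aut 𝔉.AN)
    (x : 𝔉.pre.Mon (𝔉.base.obj 𝔉.AN)) :
    (eN.trans (𝔉.pullIso a).symm) (𝔉.pullAut u x) =
      𝔉.pullAut (a.symm ≪≫ Ψ.functor.mapIso u ≪≫ a) ((eN.trans (𝔉.pullIso a).symm) x) := by
  obtain ⟨E, rfl, -⟩ := hN
  have hL : ((E.iso 𝔉.AN).trans (𝔉.pullIso a).symm) (𝔉.pullAut u x) =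
      𝔉.pre.pull (𝔉.base.map (a.inv ≫ Ψ.functor.map u.inv)) (E.iso 𝔉.AN x) := by
    change 𝔉.pre.pull (𝔉.base.map a.inv) (E.iso 𝔉.AN (𝔉.pre.pull (𝔉.base.map u.inv) x)) = _
    rw [E.natural, ← 𝔉.pre.pull_comp, ← Functor.map_comp]
  have hR : 𝔉.pullAut (a.symm ≪≫ Ψ.functor.mapIso u ≪≫ a) (((E.iso 𝔉.AN).trans (𝔉.pullIso a).symm) x) =
      𝔉.pre.pull (𝔉.base.map (a.inv ≫ Ψ.functor.map u.inv)) (E.iso 𝔉.AN x) := by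
    change 𝔉.pre.pull (𝔉.base.map (a.symm ≪≫ Ψ.functor.mapIso u ≪≫ a).inv)
      (𝔉.pre.pull (𝔉.base.map a.inv) (E.iso 𝔉.AN x)) = _
    rw [← 𝔉.pre.pull_comp, ← Functor.map_comp]
    congr 2
    simp only [Iso.trans_inv, Iso.symm_inv, Functor.mapIso_inv, Category.assoc, Iso.hom_inv_id, Category.comp_id]
  rw [hL, hR]

/-- The inverse direction of the equivariance, for convenience: `ψ_a⁻¹ ((a⁻¹Ψ(u)a)·y) = u·(ψ_a⁻¹ y)`.
[cite: MochizukiFrdI2008, Thm. 4.9 p.88] -/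
theorem psiPhiN_symm_pullAut {Ψ : C ≌ C}
    {eN : 𝔉.pre.Mon (𝔉.base.obj 𝔉.AN) ≃* 𝔉.pre.Mon (𝔉.base.obj (Ψ.functor.obj 𝔉.AN))}
    (hN : (DivisorTransportStub.ofThm49 𝔉).IsInducedBy Ψ 𝔉.AN eN) (a : Ψ.functor.obj 𝔉.AN ≅ 𝔉.AN) (u : Aut 𝔉.AN)
    (y : 𝔉.pre.Mon (𝔉.base.obj 𝔉.AN)) :
    (eN.trans (𝔉.pullIso a).symm).symm (𝔉.pullAut (a.symm ≪≫ Ψ.functor.mapIso u ≪≫ a) y) =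
      𝔉.pullAut u ((eN.trans (𝔉.pullIso a).symm).symm y) := by
  apply (eN.trans (𝔉.pullIso a).symm).injective
  rw [MulEquiv.apply_symm_apply, psiPhiN_pullAut 𝔉 hN a u, MulEquiv.apply_symm_apply]

/-- **(T1) assembled: ONE `Ψ`-induced `e_N` whose anchored transport `ψ_a` fixes both root divisors AND is equivariant.**
Under `hiso`, `induced` at `A_⊚`, and a normalised transport `(a, b, w)` (`hT`, `hT′`): `∃ e_N` induced by `Ψ` at `A_N` with
`ψ_a (Div s^⊓_N) = Div s^⊓_N`, `ψ_a (Div s^⊔_N) = Div s^⊔_N`, and `ψ_a (u·x) = (a⁻¹Ψ(u)a)·ψ_a(x)` for all `u ∈ Aut_C(A_N)` —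
the Frobenioid half of (T-div): whatever affine action `j ↦ εj + c` the transport `ψ_a` has on the chain of components
(Prop. 5.3 (v)), it STABILISES the root divisors, and it intertwines the anchored automorphism transport whose base image is
the base shadow of `Ψ`. [cite: MochizukiEtTh2009, Thm 5.7 p.330 (PDF p.104); Prop 5.3 (v) p.325 (PDF p.99)] -/
theorem exists_psiPhiN_fixes_rootPair_equivariant_of_transport
    (hiso : ∀ ⦃X Y : C⦄ (c : X ≅ Y), 𝔉.pre.div c.hom = 1)
    {Ψ : C ≌ C} {e : 𝔉.PhiAcirc ≃* 𝔉.pre.Mon (𝔉.base.obj (Ψ.functor.obj 𝔉.Acirc))}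
    (h : (DivisorTransportStub.ofThm49 𝔉).IsInducedBy Ψ 𝔉.Acirc e)
    (a : Ψ.functor.obj 𝔉.AN ≅ 𝔉.AN) (b : Ψ.functor.obj 𝔉.BN ≅ 𝔉.BN) (w : Aut 𝔉.BN)
    (hT : a.inv ≫ Ψ.functor.map 𝔉.sCap ≫ b.hom = 𝔉.sCap)
    (hT' : a.inv ≫ Ψ.functor.map 𝔉.sCup ≫ b.hom = 𝔉.sCup ≫ w.hom) :
    ∃ eN : 𝔉.pre.Mon (𝔉.base.obj 𝔉.AN) ≃* 𝔉.pre.Mon (𝔉.base.obj (Ψ.functor.obj 𝔉.AN)),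
      (DivisorTransportStub.ofThm49 𝔉).IsInducedBy Ψ 𝔉.AN eN ∧
      (eN.trans (𝔉.pullIso a).symm) (𝔉.pre.div 𝔉.sCap) = 𝔉.pre.div 𝔉.sCap ∧
      (eN.trans (𝔉.pullIso a).symm) (𝔉.pre.div 𝔉.sCup) = 𝔉.pre.div 𝔉.sCup ∧
      ∀ (u : Aut 𝔉.AN) (x : 𝔉.pre.Mon (𝔉.base.obj 𝔉.AN)),
        (eN.trans (𝔉.pullIso a).symm) (𝔉.pullAut u x) =
          𝔉.pullAut (a.symm ≪≫ Ψ.functor.mapIso u ≪≫ a) ((eN.trans (𝔉.pullIso a).symm) x) := by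
  obtain ⟨eN, hN, hcap, hcup⟩ := exists_psiPhiN_fixes_rootPair_of_transport 𝔉 hiso h a b w hT hT'
  exact ⟨eN, hN, hcap, hcup, fun u x => psiPhiN_pullAut 𝔉 hN a u x⟩

end ThetaFrobenioid

/-! ### At the model presentation (`𝔉.pre = PreFrobenioidData.ofModel Φ B DivB`; `ofBiKummerData` / `ofConnectedTemperoidData` by `rfl`) -/

namespace ThetaFrobenioid

variable {D : Type u'} [Category.{v'} D] {Φ B : Dᵒᵖ ⥤ CommMonCat.{w}} {DivB : B ⟶ monoidGp Φ}
  (𝔉 : ThetaFrobenioid.{w} (ModelFrobenioid Φ B DivB) D)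

/-- **(T1) at the model presentation, `hiso` DISCHARGED** ([FrdI] Thm. 5.2: for `C → F_Φ` a pre-Frobenioid isomorphisms are
isometries, abc-iut-w6-d052's `div_iso_eq_one_of_model`): a normalised transport `(a, b, w)` of the root pair of §5 data
with the model's operations has a `Ψ`-induced `e_N` whose anchored transport fixes `Div s^⊓_N`, `Div s^⊔_N` and is equivariant.
[cite: MochizukiEtTh2009, Thm 5.7 p.330 (PDF p.104)] -/
theorem exists_psiPhiN_fixes_rootPair_equivariant_of_transport_of_model
    (h𝔉 : 𝔉.pre = PreFrobenioidData.ofModel Φ B DivB) (hP : IsPreFrobenioid Φ (ModelFrobenioid.toElem Φ B DivB))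
    {Ψ : ModelFrobenioid Φ B DivB ≌ ModelFrobenioid Φ B DivB}
    {e : 𝔉.PhiAcirc ≃* 𝔉.pre.Mon (𝔉.base.obj (Ψ.functor.obj 𝔉.Acirc))}
    (h : (DivisorTransportStub.ofThm49 𝔉).IsInducedBy Ψ 𝔉.Acirc e)
    (a : Ψ.functor.obj 𝔉.AN ≅ 𝔉.AN) (b : Ψ.functor.obj 𝔉.BN ≅ 𝔉.BN) (w : Aut 𝔉.BN)
    (hT : a.inv ≫ Ψ.functor.map 𝔉.sCap ≫ b.hom = 𝔉.sCap)
    (hT' : a.inv ≫ Ψ.functor.map 𝔉.sCup ≫ b.hom = 𝔉.sCup ≫ w.hom) :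
    ∃ eN : 𝔉.pre.Mon (𝔉.base.obj 𝔉.AN) ≃* 𝔉.pre.Mon (𝔉.base.obj (Ψ.functor.obj 𝔉.AN)),
      (DivisorTransportStub.ofThm49 𝔉).IsInducedBy Ψ 𝔉.AN eN ∧
      (eN.trans (𝔉.pullIso a).symm) (𝔉.pre.div 𝔉.sCap) = 𝔉.pre.div 𝔉.sCap ∧
      (eN.trans (𝔉.pullIso a).symm) (𝔉.pre.div 𝔉.sCup) = 𝔉.pre.div 𝔉.sCup ∧
      ∀ (u : Aut 𝔉.AN) (x : 𝔉.pre.Mon (𝔉.base.obj 𝔉.AN)),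
        (eN.trans (𝔉.pullIso a).symm) (𝔉.pullAut u x) =
          𝔉.pullAut (a.symm ≪≫ Ψ.functor.mapIso u ≪≫ a) ((eN.trans (𝔉.pullIso a).symm) x) :=
  𝔉.exists_psiPhiN_fixes_rootPair_equivariant_of_transport (div_iso_eq_one_of_model 𝔉 h𝔉 hP) h a b w hT hT'

end ThetaFrobenioid

end Literature.AnabelianGeometry.EtaleTheta
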